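import Summits.ResolutionOfSingularities.ResolutionOfSingularities.Theorems.EquisingularLiftEquisingularLiftNatReducedExceptionalPlaneLocal
import Summits.ResolutionOfSingularities.ResolutionOfSingularities.Theorems.EquisingularLiftEquisingularLiftCentreBlowupFlatExceptional
import Literature.AlgebraicGeometry.Resolution.BlowupChartMembership
import HarnessLib

/-!
# [OURS · L1 W4.5(b) · EL♮(3) · T23-A‴ (F1)] The exceptional divisor of a SECTION blow-up is a MODEL of the new point plane

Crux chain w45b, child EL♮(3) = stmt-ResolutionOfSingularities-20148 (parent EL♮ stmt-…-20038); route `EquisingularLift`. Context: the measurement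
`ND-SPECIMEN-PASS-4.md` (res-L1-w45b-lead-1 g13, 60f21288badcb20d) and the engine owner's word `T23AF-ENGINE-WORD.md` v0 (res-L1-w45b-stub-4 g11,
095471eb3c14cc91) §1 (F1): for FIBRE rounds every retained member must CARRY A MODEL — in particular the point plane `υ⁻¹{x}` born at a point step,
which today is born `NoRound` (no model). This file is the LOCAL brick behind (F1): if the upstairs step is the blow-up `τ : X' ⟶ X` of a regular
`O`-flat centre `C` (the kernel of a section) over the downstairs blow-up `υ : F' ⟶ F` of the closed regular point `x`, with model square
`j' : F' ⟶ X'` and the (non-reduced) trace identity `(C·𝒪_{X'}).comap j' = (𝓘{x}).comap υ` that the tree's `modelPointStep_of_section`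
(…NatModelPointStepOfSection) already returns, then the exceptional ideal `𝓔 := C.comap τ` has
(e-i) EXACT REDUCED trace `𝓔.comap j' = 𝓘⟨υ⁻¹{x}⟩` (by `comap_vanishingIdeal_singleton_eq_of_isRegularLocalRing`, p616407: only `𝒪_{F,x}` regular is used),
(e-ii) locally principal stalks (effective Cartier), (e-iii) `V(𝓔)` regular (tree `IsBlowup.isRegular_subscheme_comap`, Liu 8.1.19 (b)),
(e-iv) support = `τ⁻¹ supp C` (so it stays off whatever `supp C` stays off), (e-v) = FE: `V(𝓔) → Spec O` flat (tree `flat_exceptional_of_isBlowup_regularCentre`).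
Pure assembly of tree lemmas; no statement of the manuscript; AI-written, weaker than expert review. `--supports stmt-ResolutionOfSingularities-20148 --as helper`.
-/

set_option linter.dupNamespace false -- mandated namespace `Summit.<Summit>.<Problem>` of this single-conjunct summit

noncomputable section

open CategoryTheory CategoryTheory.Limits AlgebraicGeometry TopologicalSpace IsLocalRing
open Literature.AlgebraicGeometry.Resolution
open AlgebraicGeometry.Scheme.IdealSheafData
open Summit.ResolutionOfSingularities.ResolutionOfSingularities.Cruxes.EquisingularLift.StrataSplit
open scoped nonZeroDivisors

namespace Summit.ResolutionOfSingularities.ResolutionOfSingularities.Cruxes.EquisingularLiftNat.Sections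

/-- **(e-i) for a point plane — exact REDUCED trace of the exceptional divisor of the upstairs step.** If the upstairs exceptional ideal
`𝓔 = C.comap τ` traces downstairs to the PULLED-BACK point ideal `(𝓘{x}).comap υ` (the shape `modelPointStep_of_section` returns), and `x` is a closed
point with `𝒪_{F,x}` regular blown up by `υ`, then the trace is the REDUCED plane `𝓘⟨υ⁻¹{x}⟩`. [OURS · T23-A‴ (F1) brick] -/
theorem comap_comap_eq_vanishingIdeal_preimage_singleton {X X' F F' : Scheme.{0}} [IsLocallyNoetherian F]
    (C : X.IdealSheafData) (τ : X' ⟶ X) (j' : F' ⟶ X') {υ : F' ⟶ F}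
    {x : F} (hx : IsClosed ({x} : Set F)) (hreg : IsRegularLocalRing (F.presheaf.stalk x))
    (hυ : IsBlowup υ (vanishingIdeal ⟨{x}, hx⟩))
    (htrace : (C.comap τ).comap j' = (vanishingIdeal ⟨{x}, hx⟩ : F.IdealSheafData).comap υ) :
    (C.comap τ).comap j' = vanishingIdeal ⟨υ ⁻¹' {x}, hx.preimage υ.continuous⟩ := by
  rw [htrace]
  exact comap_vanishingIdeal_singleton_eq_of_isRegularLocalRing hx hreg hυ

/-- **(e-i), functorial form.** With a commuting model square `j' ≫ τ = υ ≫ j` and the section's trace `C.comap j = 𝓘{x}` (both returned by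
`modelPointStep_of_section`), the exceptional ideal traces to the reduced plane. [OURS · T23-A‴ (F1) brick] -/
theorem comap_comap_eq_vanishingIdeal_preimage_singleton_of_sq {X X' F F' : Scheme.{0}} [IsLocallyNoetherian F]
    (C : X.IdealSheafData) {τ : X' ⟶ X} {j : F ⟶ X} {j' : F' ⟶ X'} {υ : F' ⟶ F} (hsq : j' ≫ τ = υ ≫ j)
    {x : F} (hx : IsClosed ({x} : Set F)) (hreg : IsRegularLocalRing (F.presheaf.stalk x))
    (hυ : IsBlowup υ (vanishingIdeal ⟨{x}, hx⟩)) (hC : C.comap j = vanishingIdeal ⟨{x}, hx⟩) :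
    (C.comap τ).comap j' = vanishingIdeal ⟨υ ⁻¹' {x}, hx.preimage υ.continuous⟩ := by
  refine comap_comap_eq_vanishingIdeal_preimage_singleton C τ j' hx hreg hυ ?_
  rw [← comap_comp, hsq, comap_comp, hC]

/-- **(e-ii) for a point plane**: the exceptional ideal of a blow-up has principal stalks (effective Cartier). [OURS · T23-A‴ (F1) brick; tree
`IsBlowup.isEffectiveCartier`] -/
theorem isPrincipal_stalkIdeal_comap_of_isBlowup {X X' : Scheme.{0}} (C : X.IdealSheafData) {τ : X' ⟶ X} (hτ : IsBlowup τ C) (z : X') :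
    (stalkIdeal (C.comap τ) z).IsPrincipal := by
  obtain ⟨u, -, hu⟩ := IsEffectiveCartier.exists_stalkIdeal_eq_span hτ.isEffectiveCartier z
  exact ⟨⟨u, by rw [hu, Ideal.submodule_span_eq]⟩⟩

/-- **(e-iv) for a point plane**: the image of the exceptional support under `τ ≫ σ` is the image of the centre's support under `σ`; so it avoids
every set the centre's image avoids (the engine's «off the generic point of `Y`»). [OURS · T23-A‴ (F1) brick] -/
theorem image_support_comap_subset {X X' P : Scheme.{0}} (C : X.IdealSheafData) (τ : X' ⟶ X) (σ : X ⟶ P) {N : Set P}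
    (hN : σ '' (C.support : Set X) ⊆ N) : (τ ≫ σ) '' ((C.comap τ).support : Set X') ⊆ N := by
  rintro _ ⟨z, hz, rfl⟩
  rw [support_comap] at hz
  exact hN ⟨τ z, hz, rfl⟩

/-- **THE POINT-PLANE MODEL (T23-A‴ (F1))** — all five clauses at once. Upstairs: `X` regular locally Noetherian over `Spec O` (`r`), `C` an ideal
sheaf with `V(C)` regular and `V(C) → Spec O` flat (a section's kernel: `section_isClosedImmersion_and_isRegular_ker` / `flat_kerSubschemeι_comp_of_section`),
`τ` the blow-up of `C`; downstairs: `υ` the blow-up of the closed point `x` with `𝒪_{F,x}` regular; model squares `j`, `j'` with `j' ≫ τ = υ ≫ j` and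
`C.comap j = 𝓘{x}`. Then `𝓔 := C.comap τ` satisfies: (e-i) `𝓔.comap j' = 𝓘⟨υ⁻¹{x}⟩`; (e-ii) principal stalks; (e-iii) `V(𝓔)` regular; (e-iv) `(τ ≫ σ) '' supp 𝓔 ⊆ N`
whenever `σ '' supp C ⊆ N`; (e-v) `V(𝓔) → Spec O` flat. [OURS · T23-A‴ (F1) brick; assembly of p616407 + Liu 8.1.19 (b) tree lemmas] -/
theorem pointPlane_model {O : Type} [CommRing O] {X X' F F' P : Scheme.{0}} [IsLocallyNoetherian X] [IsLocallyNoetherian F]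
    (hXreg : Scheme.IsRegular X) (r : X ⟶ Spec (.of O)) (σ : X ⟶ P) (N : Set P)
    (C : X.IdealSheafData) (hCreg : Scheme.IsRegular C.subscheme) (hCflat : Flat (C.subschemeι ≫ r)) (hCN : σ '' (C.support : Set X) ⊆ N)
    {τ : X' ⟶ X} (hτ : IsBlowup τ C)
    {j : F ⟶ X} {j' : F' ⟶ X'} {υ : F' ⟶ F} (hsq : j' ≫ τ = υ ≫ j)
    {x : F} (hx : IsClosed ({x} : Set F)) (hreg : IsRegularLocalRing (F.presheaf.stalk x))
    (hυ : IsBlowup υ (vanishingIdeal ⟨{x}, hx⟩)) (hC : C.comap j = vanishingIdeal ⟨{x}, hx⟩) :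
    (C.comap τ).comap j' = vanishingIdeal ⟨υ ⁻¹' {x}, hx.preimage υ.continuous⟩ ∧
    (∀ z : X', (stalkIdeal (C.comap τ) z).IsPrincipal) ∧
    Scheme.IsRegular (C.comap τ).subscheme ∧
    (τ ≫ σ) '' ((C.comap τ).support : Set X') ⊆ N ∧
    Flat ((C.comap τ).subschemeι ≫ τ ≫ r) :=
  ⟨comap_comap_eq_vanishingIdeal_preimage_singleton_of_sq C hsq hx hreg hυ hC,
    isPrincipal_stalkIdeal_comap_of_isBlowup C hτ,
    hτ.isRegular_subscheme_comap hXreg hCreg,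
    image_support_comap_subset C τ σ hCN,
    flat_exceptional_of_isBlowup_regularCentre O X X' r C hXreg hCreg hCflat τ hτ⟩

end Summit.ResolutionOfSingularities.ResolutionOfSingularities.Cruxes.EquisingularLiftNat.Sections

end
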